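import Summits.QuantumFields.BalabanUV.T4Continuum.Spine.NE2.ComposedRemainderCoherentTowerReduced
import Summits.QuantumFields.BalabanUV.T4Continuum.Spine.NE2.ComposedAveragingFlatWitness

/-!
# NE2 / FullOperatorWitnessNonTrivial — THE FULL TIER-B PERTURBATION OF THE END's OPERATOR IS A NON-ZERO OPERATOR AT THE WITNESS TOWERS
# (cell `pub-balaban-gaps`, seat ne2, generation 10; row NE2 of `HOME/BALABAN-GAPS.md`; settles the «NOT CLAIMED» clause of generation 9's `ConstantTransporterLaplacian` ∕
# `ComposedRemainderCoherentTowerReduced`)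

HONEST FRAMING.  Row NE2 (node U1a of the T⁴ uniqueness spine) is NOT PRINTED and NOT PROVED; class word WORK-bound; nothing of Bałaban's is asserted beyond print;
ONE finite torus; NOT ℝ⁴, NOT infinite volume, NOT a mass gap, NOT Clay.  [folklore] finite-dimensional algebra about the TREE's model operators at TOY data; no word changes.

WHAT IT SETTLES.  Generation 9 showed that at the non-flat witness towers `cTow f X` (non-central `X`) the covariant-Laplacian SUMMAND `covPertC(Ad u_top) k` of
`tierBPert R P₃ P₄ k = covPertC R k + P₃ k + P₄ k` is a non-zero operator and left open whether the composed-averaging summand `P₃ = avgPertFull a T E″ =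
a·((B + E(T) + E″)ᴴ(B + E(T) + E″) − BᴴB)` could compensate it.  IT CANNOT (`d ≥ 3`, block side `L^k ≥ 2`): §1 product test fields `g ⊗ φ` and two Gram identities;
§2 for a CONSTANT UNITARY transporter `A` the operator identity `Δ^A − Δ ⊗ 1 = −|c|²·Σ_ν (S_ν ⊗ (A − 1) + h.c.)` (`covLapC_const_sub_lapC`) and its form at a real product field,
`= |c|²·(Σ_ν⟨g, S_νg⟩)·‖(A − 1)φ‖²` (`form_covPert_const`); §3 ON `ker B_k` THE GRAM SUMMAND IS `a‖E_kv‖² ≥ 0` FOR ANY transport error `E` (`form_gramPert_of_ker`) — no knowledge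
of the tables, of `E(T)` or of the (124)-remainders is needed; §4 a scalar test 1-form `gtest` IN THE KERNEL OF BAŁABAN's AVERAGING (1.18) (`QvOp_mulVec_gtest`: profile
`[x_ν = 0] − [x_ν = 1]` across one block, constant along the contours, so every block line-sum cancels) with shift correlation `≥ 1` (`one_le_shiftCorr`, `d ≥ 3`);
§5 **`tierBPert_const_gram_ne_zero`** (constant unitary `A_k ≠ 1`, `a ≥ 0`, ANY `E`), **`tierBPert_const_avgPertFull_ne_zero`** (ANY tables `T`, remainders `E″`),
**`tierBPert_cTow_ne_zero`** (the witness towers, non-central `X`) and **`reducedEND_operator_ne_free`**: the operator displayed in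
`exists_nonflat_coherent_witness_reduced` is NOT the free block-Laplacian tower `calDalev ⊗ 1` — which IS its value at the flat tower (`tierBPert_flat_tables_eq_zero`).
Locator (shape only): [B9] (3.3) p. 390, (3.16) p. 393, (3.26) p. 395; [B5] (1.18) p. 20.  0 sorry; axioms ⊆ {propext, Classical.choice, Quot.sound}.
-/

noncomputable section

open scoped BigOperators ComplexConjugate Matrix Matrix.Norms.L2Operator Kronecker ComplexOrder

namespace Summit.QuantumFields.BalabanUV.T4Continuum.NE2.FullOperatorWitnessNonTrivial

open Literature.MathematicalPhysics.QuantumFieldTheory.Balaban1983to89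
open Literature.MathematicalPhysics.QuantumFieldTheory.Balaban1983to89.B5Prop11Plancherel (Tor fine shiftM fdiff unitVec)
open Literature.MathematicalPhysics.QuantumFieldTheory.Balaban1983to89.B5Block118 (QvOp QvOp_mulVec lineSum bpt up iota tstep upHom upHom_intCast)
open Literature.MathematicalPhysics.QuantumFieldTheory.Balaban1983to89.B5G183RateUnitTower (lev)
open Literature.MathematicalPhysics.QuantumFieldTheory.Balaban1983to89.B9AdOrthogonal (herm0)
open Summit.QuantumFields.BalabanUV.Beta.AdjointCarrierWiringEnd (CompFamily)
open Summit.QuantumFields.BalabanUV.T4Continuum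
open Summit.QuantumFields.BalabanUV.T4Continuum.BalabanAveragedTowerUnit (idx)
open Summit.QuantumFields.BalabanUV.T4Continuum.BlockPairingGeometry (conjTranspose_shiftM_mul)
open Summit.QuantumFields.BalabanUV.T4Continuum.ColourCovariantLaplacian (covDc covLapC lapC covPertC)
open Summit.QuantumFields.BalabanUV.T4Continuum.CovariantBlockAveraging (Bfree sqrtVol)
open Summit.QuantumFields.BalabanUV.T4Continuum.GramPerturbationLaw (gramPert gramCore)
open Summit.QuantumFields.BalabanUV.T4Continuum.KingPairingPlantedLaw (calDalev)
open Summit.QuantumFields.BalabanUV.T4Continuum.NE2BalabanLayer (tierBPert)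
open Summit.QuantumFields.BalabanUV.T4Continuum.NE2.CovariantTableAveraging (Table)
open Summit.QuantumFields.BalabanUV.T4Continuum.NE2.CovariantTableTower (EcovT)
open Summit.QuantumFields.BalabanUV.T4Continuum.NE2.CovariantTableBalaban (TBal)
open Summit.QuantumFields.BalabanUV.T4Continuum.NE2.ComposedAveragingRemainder (avgPertFull avgPertFull_zero)
open Summit.QuantumFields.BalabanUV.T4Continuum.NE2.ComposedAveragingFlatWitness (avgPertT_TBal_one)
open Summit.QuantumFields.BalabanUV.T4Continuum.NE2.AdjointFieldInstance (adRep adRep_mem_unitaryGroup)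
open Summit.QuantumFields.BalabanUV.T4Continuum.NE2.ComposedRemainderGaugeTower (adT)
open Summit.QuantumFields.BalabanUV.T4Continuum.NE2.ComposedRemainderGaugeTowerRegular (topAdT)
open Summit.QuantumFields.BalabanUV.T4Continuum.NE2.ComposedRemainderCoherentTower (liftU)
open Summit.QuantumFields.BalabanUV.T4Continuum.NE2.ConstantConnectionTower (cTow cTow_mem exp_smul_mem_unitaryGroup)
open Summit.QuantumFields.BalabanUV.T4Continuum.NE2.AdjointRepresentationKernel (topAdT_cTow_eq_one_iff)
open Summit.QuantumFields.BalabanUV.T4Continuum.NE2.ConstantTransporterLaplacian (covDc_const finsetSum_mulVec covPertC_const_eq_zero_iff topAdT_cTow_eq_const)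

variable {d : ℕ}

/-! ## §1 Product test fields and two Gram identities (§3 is `form_gramPert_of_ker`) -/

section Prod

/-- the product (Kronecker) test field `g ⊗ φ : (p, a) ↦ g(p)·φ(a)`. [folklore] -/
def pvec {β δ : Type*} (g : β → ℂ) (φ : δ → ℂ) : β × δ → ℂ := fun p => g p.1 * φ p.2

/-- `(X ⊗ Y)(g ⊗ φ) = (Xg) ⊗ (Yφ)`. [folklore] -/
theorem kron_mulVec_pvec {α β γ δ : Type*} [Fintype β] [Fintype δ] (X : Matrix α β ℂ) (Y : Matrix γ δ ℂ) (g : β → ℂ) (φ : δ → ℂ) :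
    (X ⊗ₖ Y) *ᵥ pvec g φ = pvec (X *ᵥ g) (Y *ᵥ φ) := by
  funext p
  simp only [Matrix.mulVec, dotProduct, Matrix.kroneckerMap_apply, pvec]
  rw [Fintype.sum_prod_type, Finset.sum_mul_sum]
  exact Finset.sum_congr rfl fun j _ => Finset.sum_congr rfl fun b _ => by ring

/-- `⟨g ⊗ φ, g′ ⊗ φ′⟩ = ⟨g, g′⟩·⟨φ, φ′⟩`. [folklore] -/
theorem star_pvec_dotProduct_pvec {β δ : Type*} [Fintype β] [Fintype δ] (g g' : β → ℂ) (φ φ' : δ → ℂ) :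
    star (pvec g φ) ⬝ᵥ pvec g' φ' = (star g ⬝ᵥ g') * (star φ ⬝ᵥ φ') := by
  simp only [dotProduct, Pi.star_apply, pvec, star_mul']
  rw [Fintype.sum_prod_type, Finset.sum_mul_sum]
  exact Finset.sum_congr rfl fun j _ => Finset.sum_congr rfl fun b _ => by ring

/-- `g ⊗ φ = 0` once `g = 0`. [folklore] -/
theorem pvec_zero_left {β δ : Type*} (φ : δ → ℂ) : pvec (0 : β → ℂ) φ = 0 := by
  funext p; simp [pvec]

/-- `v̄·((DᴴD)v) = (Dv)‾·(Dv)` for a RECTANGULAR `D`. [folklore] -/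
theorem star_dotProduct_conjTranspose_mul_self_mulVec' {σ τ : Type*} [Fintype σ] [Fintype τ] (D : Matrix σ τ ℂ) (v : τ → ℂ) :
    star v ⬝ᵥ ((Dᴴ * D) *ᵥ v) = star (D *ᵥ v) ⬝ᵥ (D *ᵥ v) := by
  rw [← Matrix.mulVec_mulVec, Matrix.dotProduct_mulVec, Matrix.vecMul_conjTranspose, star_star]

/-- `v̄·(Xᴴv) = (v̄·(Xv))‾`. [folklore] -/
theorem star_dotProduct_conjTranspose_mulVec {σ : Type*} [Fintype σ] (X : Matrix σ σ ℂ) (v : σ → ℂ) :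
    star v ⬝ᵥ (Xᴴ *ᵥ v) = star (star v ⬝ᵥ (X *ᵥ v)) := by
  rw [Matrix.dotProduct_mulVec, Matrix.vecMul_conjTranspose, star_star, Matrix.star_dotProduct]

/-- `(c(P − 1))ᴴ(c(P − 1)) = |c|²(2 − P − Pᴴ)` when `PᴴP = 1`. [folklore] -/
theorem gram_of_isometry {σ : Type*} [Fintype σ] [DecidableEq σ] {P : Matrix σ σ ℂ} (hP : Pᴴ * P = 1) (c : ℂ) :
    (c • (P - 1))ᴴ * (c • (P - 1)) = (star c * c) • (1 + 1 - P - Pᴴ) := by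
  rw [Matrix.conjTranspose_smul, Matrix.smul_mul, Matrix.mul_smul, smul_smul, Matrix.conjTranspose_sub, Matrix.conjTranspose_one,
    Matrix.sub_mul, Matrix.mul_sub, Matrix.mul_sub, Matrix.one_mul, Matrix.mul_one, Matrix.one_mul, hP]
  congr 1; abel

/-- for unitary `A`: `⟨φ, (A − 1)φ⟩ + ⟨φ, (A − 1)φ⟩‾ = −‖(A − 1)φ‖²`. [folklore] -/
theorem twoRe_form_sub_one {o : Type*} [Fintype o] [DecidableEq o] {A : Matrix o o ℂ} (hA : A ∈ Matrix.unitaryGroup o ℂ) (φ : o → ℂ) :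
    star φ ⬝ᵥ ((A - 1) *ᵥ φ) + star (star φ ⬝ᵥ ((A - 1) *ᵥ φ)) = -(star ((A - 1) *ᵥ φ) ⬝ᵥ ((A - 1) *ᵥ φ)) := by
  have hiso : star (A *ᵥ φ) ⬝ᵥ (A *ᵥ φ) = star φ ⬝ᵥ φ := by
    rw [← star_dotProduct_conjTranspose_mul_self_mulVec', show Aᴴ * A = 1 from Matrix.mem_unitaryGroup_iff'.mp hA, Matrix.one_mulVec]
  have hb : star (star φ ⬝ᵥ φ) = star φ ⬝ᵥ φ := by rw [← Matrix.star_dotProduct]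
  have hcross : star (A *ᵥ φ) ⬝ᵥ φ = star (star φ ⬝ᵥ (A *ᵥ φ)) := by rw [Matrix.star_dotProduct]
  have hv : (A - 1) *ᵥ φ = A *ᵥ φ - φ := by rw [Matrix.sub_mulVec, Matrix.one_mulVec]
  rw [hv, star_sub (A *ᵥ φ) φ]
  simp only [sub_dotProduct, dotProduct_sub, hiso, hcross, star_sub, hb]
  ring

variable {ι : ℕ → Type*} [∀ k, Fintype (ι k)] {σ : Type*} [Fintype σ]

/-- §3 — **ON `ker B_k` THE GRAM SUMMAND IS `a‖E_kv‖²`**: `B_kv = 0 ⟹ ⟨v, a((B+E)ᴴ(B+E) − BᴴB)_k v⟩ = a·⟨E_kv, E_kv⟩`, for ANY transport error `E`. [folklore] -/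
theorem form_gramPert_of_ker (a : ℂ) (B E : (k : ℕ) → Matrix σ (ι k) ℂ) (k : ℕ) {v : ι k → ℂ} (hv : B k *ᵥ v = 0) :
    star v ⬝ᵥ (gramPert a B E k *ᵥ v) = a * (star (E k *ᵥ v) ⬝ᵥ (E k *ᵥ v)) := by
  rw [gramPert, gramCore, Matrix.smul_mulVec, dotProduct_smul, Matrix.sub_mulVec, dotProduct_sub, star_dotProduct_conjTranspose_mul_self_mulVec',
    star_dotProduct_conjTranspose_mul_self_mulVec', Matrix.add_mulVec, hv, zero_add, star_zero, zero_dotProduct, sub_zero, smul_eq_mul]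

end Prod

/-! ## §2 The covariant-Laplacian perturbation of a constant unitary transporter: operator identity and quadratic form -/

section Const

variable (Nf : Fin d → ℕ) [hNf : ∀ μ, NeZero (Nf μ)] {o : Type} [Fintype o] [DecidableEq o]

omit hNf [Fintype o] [DecidableEq o] in
/-- `S_ν ⊗ (A − B) = S_ν ⊗ A − S_ν ⊗ B`. [folklore] -/
theorem shiftM_kronecker_sub (ν : Fin d) (A B : Matrix o o ℂ) : shiftM Nf ν ⊗ₖ (A - B) = shiftM Nf ν ⊗ₖ A - shiftM Nf ν ⊗ₖ B := by
  ext ⟨i, a⟩ ⟨j, b⟩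
  simp only [Matrix.kroneckerMap_apply, Matrix.sub_apply, mul_sub]

/-- `(S_ν ⊗ A)ᴴ(S_ν ⊗ A) = 1` for unitary `A` (the shift is a permutation). [folklore] -/
theorem conjTranspose_shiftKron_mul_self (ν : Fin d) {A : Matrix o o ℂ} (hA : A ∈ Matrix.unitaryGroup o ℂ) :
    (shiftM Nf ν ⊗ₖ A)ᴴ * (shiftM Nf ν ⊗ₖ A) = 1 := by
  rw [Matrix.conjTranspose_kronecker (shiftM Nf ν) A, ← Matrix.mul_kronecker_mul, conjTranspose_shiftM_mul,
    show Aᴴ * A = 1 from Matrix.mem_unitaryGroup_iff'.mp hA, Matrix.one_kronecker_one]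

/-- **`Δ^A − Δ ⊗ 1 = −|c|²·Σ_ν (S_ν ⊗ (A − 1) + (S_ν ⊗ (A − 1))ᴴ)`** for a CONSTANT UNITARY transporter `A`. [cite: Balaban1985BackgroundPropagators, (3.3) p.390 (shape)] [folklore] -/
theorem covLapC_const_sub_lapC {A : Matrix o o ℂ} (hA : A ∈ Matrix.unitaryGroup o ℂ) (c : ℂ) :
    covLapC Nf c (fun _ _ => A) - lapC Nf c = -((star c * c) • ∑ ν, (shiftM Nf ν ⊗ₖ (A - 1) + (shiftM Nf ν ⊗ₖ (A - 1))ᴴ)) := by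
  rw [covLapC, lapC, ← Finset.sum_sub_distrib, Finset.smul_sum, ← Finset.sum_neg_distrib]
  refine Finset.sum_congr rfl fun ν _ => ?_
  have hS1 : fdiff Nf c ν ⊗ₖ (1 : Matrix o o ℂ) = c • (shiftM Nf ν ⊗ₖ (1 : Matrix o o ℂ) - 1) := by
    rw [fdiff, Matrix.smul_kronecker, KroneckerLift.sub_kronecker, Matrix.one_kronecker_one]
  rw [covDc_const, hS1, gram_of_isometry (conjTranspose_shiftKron_mul_self Nf ν hA) c,
    gram_of_isometry (conjTranspose_shiftKron_mul_self Nf ν (one_mem _)) c, ← smul_sub, ← smul_neg]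
  congr 1
  rw [shiftM_kronecker_sub, Matrix.conjTranspose_sub]
  abel

/-- **THE QUADRATIC FORM OF `Δ^A − Δ ⊗ 1` AT A REAL PRODUCT TEST FIELD**: `⟨g ⊗ φ, (Δ^A − Δ ⊗ 1)(g ⊗ φ)⟩ = |c|²·(Σ_ν ⟨g, S_νg⟩)·‖(A − 1)φ‖²` (`A` unitary, `ḡ = g`). [folklore] -/
theorem form_covPert_const {A : Matrix o o ℂ} (hA : A ∈ Matrix.unitaryGroup o ℂ) (c : ℂ) {g : Tor Nf × Fin d → ℂ} (hg : star g = g) (φ : o → ℂ) :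
    star (pvec g φ) ⬝ᵥ ((covLapC Nf c (fun _ _ => A) - lapC Nf c) *ᵥ pvec g φ)
      = (star c * c) * (∑ ν, star g ⬝ᵥ (shiftM Nf ν *ᵥ g)) * (star ((A - 1) *ᵥ φ) ⬝ᵥ ((A - 1) *ᵥ φ)) := by
  have hreal : ∀ ν, star (star g ⬝ᵥ (shiftM Nf ν *ᵥ g)) = star g ⬝ᵥ (shiftM Nf ν *ᵥ g) := fun ν => by
    rw [← Matrix.star_dotProduct, dotProduct, dotProduct]
    refine Finset.sum_congr rfl fun p _ => ?_
    have e : (shiftM Nf ν *ᵥ g) p = g (p.1 + unitVec Nf ν, p.2) := by simp [Matrix.mulVec, dotProduct, shiftM]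
    have h1 : star (g p) = g p := congrFun hg p
    have h2 : star (g (p.1 + unitVec Nf ν, p.2)) = g (p.1 + unitVec Nf ν, p.2) := congrFun hg _
    rw [Pi.star_apply, Pi.star_apply, e, h1, h2, mul_comm]
  have hν : ∀ ν, star (pvec g φ) ⬝ᵥ ((shiftM Nf ν ⊗ₖ (A - 1) + (shiftM Nf ν ⊗ₖ (A - 1))ᴴ) *ᵥ pvec g φ)
      = (star g ⬝ᵥ (shiftM Nf ν *ᵥ g)) * -(star ((A - 1) *ᵥ φ) ⬝ᵥ ((A - 1) *ᵥ φ)) := fun ν => by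
    rw [Matrix.add_mulVec, dotProduct_add, star_dotProduct_conjTranspose_mulVec, kron_mulVec_pvec, star_pvec_dotProduct_pvec, star_mul', hreal ν,
      ← mul_add, twoRe_form_sub_one hA φ]
  rw [covLapC_const_sub_lapC Nf hA c, Matrix.neg_mulVec, dotProduct_neg, Matrix.smul_mulVec, dotProduct_smul, finsetSum_mulVec, dotProduct_sum, smul_eq_mul]
  simp_rw [hν]
  rw [← Finset.sum_mul]
  ring

end Const

/-! ## §4 The scalar test 1-form in the kernel of Bałaban's averaging (1.18) -/

section Test

variable (n : ℕ) [NeZero n] (M : Fin d → ℕ) [hM : ∀ μ, NeZero (M μ)]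

/-- the real profile `r(w) = [w = 0] − [w = 1]` on one coordinate circle. [folklore] -/
def rfun (N : ℕ) (w : ZMod N) : ℝ := (if w = 0 then 1 else 0) - (if w = 1 then 1 else 0)

/-- **THE TEST 1-FORM** `g(x, μ) = [μ = μ₀]·r(x_ν)`: supported on the `μ₀`-components, depending on the transverse coordinate `x_ν` only. [folklore] -/
def gtest (μ₀ ν : Fin d) : Tor (fine n M) × Fin d → ℂ := fun p => if p.2 = μ₀ then ((rfun (fine n M ν) (p.1 ν) : ℝ) : ℂ) else 0

/-- the profile read along the fine torus. [folklore] -/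
def rT (ν : Fin d) (x : Tor (fine n M)) : ℝ := rfun (fine n M ν) (x ν)

omit [NeZero n] hM in
/-- `gtest` is real. [folklore] -/
theorem star_gtest (μ₀ ν : Fin d) : star (gtest n M μ₀ ν) = gtest n M μ₀ ν := by
  funext p
  rw [Pi.star_apply, gtest]
  split_ifs; exacts [Complex.conj_ofReal _, star_zero _]

omit [NeZero n] in
/-- KEY ARITHMETIC: inside `ℤ/(nM_ν)`, `n·y + i = r` with `i, r < n` forces `n·y = 0` and `i = r`. [folklore] -/
theorem upHom_add_natCast_eq_iff (ν : Fin d) (y : ZMod (M ν)) {i r : ℕ} (hi : i < n) (hr : r < n) :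
    upHom n M ν y + (i : ZMod (fine n M ν)) = (r : ZMod (fine n M ν)) ↔ upHom n M ν y = 0 ∧ i = r := by
  refine ⟨fun h => ?_, fun ⟨h0, hir⟩ => by rw [h0, zero_add, hir]⟩
  let ψ : ZMod (fine n M ν) →+* ZMod n := ZMod.castHom (dvd_mul_right n (M ν)) (ZMod n)
  have hU : ψ (upHom n M ν y) = 0 := by
    have hy : y = (((y.val : ℕ) : ℤ) : ZMod (M ν)) := by rw [Int.cast_natCast, ZMod.natCast_zmod_val]
    rw [hy, upHom_intCast, map_mul, map_natCast, ZMod.natCast_self, zero_mul]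
  have hir : i = r := by
    have := congrArg ψ h
    rw [map_add, hU, zero_add, map_natCast, map_natCast, ZMod.natCast_eq_natCast_iff', Nat.mod_eq_of_lt hi, Nat.mod_eq_of_lt hr] at this
    exact this
  refine ⟨?_, hir⟩
  rw [hir] at h
  exact add_right_cancel (h.trans (zero_add _).symm)

omit [NeZero n] in
/-- the block sums of the profile vanish: `Σ_{j} r(n·y_ν + j_ν) = 0` over the offsets `j ∈ {0,…,n−1}^d` of one block (`n ≥ 2`). [folklore] -/
theorem sum_rfun_block (hn : 2 ≤ n) (ν : Fin d) (y : ZMod (M ν)) :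
    ∑ j : Fin d → Fin n, rfun (fine n M ν) (upHom n M ν y + ((j ν : ℕ) : ZMod (fine n M ν))) = 0 := by
  have h0n : 0 < n := by omega
  have h1n : 1 < n := by omega
  have hind : ∀ (j : Fin d → Fin n) (r : ℕ) (hr : r < n),
      (upHom n M ν y + ((j ν : ℕ) : ZMod (fine n M ν)) = (r : ZMod (fine n M ν))) ↔ (upHom n M ν y = 0 ∧ j ν = ⟨r, hr⟩) := fun j r hr => by
    rw [upHom_add_natCast_eq_iff n M ν y (j ν).isLt hr, Fin.ext_iff]
  have hterm : ∀ j : Fin d → Fin n, rfun (fine n M ν) (upHom n M ν y + ((j ν : ℕ) : ZMod (fine n M ν)))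
      = (if upHom n M ν y = 0 ∧ j ν = ⟨0, h0n⟩ then 1 else 0) - (if upHom n M ν y = 0 ∧ j ν = ⟨1, h1n⟩ then 1 else 0) := fun j => by
    rw [rfun]
    congr 1
    · exact if_congr ((show _ = (0 : ZMod (fine n M ν)) ↔ _ = ((0 : ℕ) : ZMod (fine n M ν)) by rw [Nat.cast_zero]).trans (hind j 0 h0n)) rfl rfl
    · exact if_congr ((show _ = (1 : ZMod (fine n M ν)) ↔ _ = ((1 : ℕ) : ZMod (fine n M ν)) by rw [Nat.cast_one]).trans (hind j 1 h1n)) rfl rfl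
  simp_rw [hterm]
  rw [Finset.sum_sub_distrib, sub_eq_zero]
  exact (Fintype.sum_equiv (Equiv.piCongrRight fun _ : Fin d => Equiv.swap (⟨0, h0n⟩ : Fin n) ⟨1, h1n⟩) _ _ fun j => by
    simp only [Equiv.piCongrRight_apply, Pi.map_apply, Equiv.swap_apply_eq_iff, Equiv.swap_apply_left]).symm

/-- **`gtest ∈ ker Q_k`**: Bałaban's averaging (1.18) of the test 1-form vanishes — each straight contour of `n` bonds in direction `μ₀` starting in a block reads the
profile at the fixed transverse coordinate of its starting point, and the block sum over starting points cancels. [cite: Balaban1984PropagatorsI, (1.18) p.20 (shape)] [folklore] -/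
theorem QvOp_mulVec_gtest (hn : 2 ≤ n) {μ₀ ν : Fin d} (hne : ν ≠ μ₀) : QvOp n M *ᵥ gtest n M μ₀ ν = 0 := by
  funext ⟨y, μ⟩
  rw [QvOp_mulVec, Pi.zero_apply]
  refine mul_eq_zero_of_right _ ?_
  by_cases hμ : μ = μ₀
  · subst hμ
    have hline : ∀ j : Fin d → Fin n, lineSum n M (gtest n M μ ν) (bpt n M y j) μ
        = (n : ℂ) * ((rfun (fine n M ν) (upHom n M ν (y ν) + ((j ν : ℕ) : ZMod (fine n M ν))) : ℝ) : ℂ) := fun j => by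
      have hpt : ∀ t : Fin n, gtest n M μ ν (bpt n M y j + tstep (fine n M) μ t, μ)
          = ((rfun (fine n M ν) (upHom n M ν (y ν) + ((j ν : ℕ) : ZMod (fine n M ν))) : ℝ) : ℂ) := fun t => by
        simp only [gtest, ite_true, bpt, up, iota, tstep, Pi.add_apply, if_neg hne, add_zero]
      rw [lineSum]; simp_rw [hpt]; rw [Finset.sum_const, Finset.card_univ, Fintype.card_fin, nsmul_eq_mul]
    simp_rw [hline]
    rw [← Finset.mul_sum, ← Complex.ofReal_sum, sum_rfun_block n M hn ν (y ν), Complex.ofReal_zero, mul_zero]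
  · refine Finset.sum_eq_zero fun j _ => Finset.sum_eq_zero fun t _ => ?_
    simp only [gtest, if_neg hμ]

/-- **THE SHIFT CORRELATIONS OF THE TEST 1-FORM ARE REAL**: `⟨g, S_κ g⟩ = Σ_x r(x_ν)·r((x + e_κ)_ν)`. [folklore] -/
theorem shiftCorr_gtest (μ₀ ν κ : Fin d) :
    star (gtest n M μ₀ ν) ⬝ᵥ (shiftM (fine n M) κ *ᵥ gtest n M μ₀ ν) = ((∑ x : Tor (fine n M), rT n M ν x * rT n M ν (x + unitVec (fine n M) κ) : ℝ) : ℂ) := by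
  rw [dotProduct, Fintype.sum_prod_type, Complex.ofReal_sum]
  refine Finset.sum_congr rfl fun x _ => ?_
  have hS : ∀ μ, (shiftM (fine n M) κ *ᵥ gtest n M μ₀ ν) (x, μ) = gtest n M μ₀ ν (x + unitVec (fine n M) κ, μ) := fun μ => by
    simp [Matrix.mulVec, dotProduct, shiftM]
  simp_rw [hS, Pi.star_apply]
  rw [Finset.sum_eq_single μ₀ (fun μ _ hμ => by simp only [gtest, if_neg hμ, mul_zero]) (fun h => absurd (Finset.mem_univ _) h)]
  simp only [gtest, ite_true, Complex.star_def, Complex.conj_ofReal, rT, Complex.ofReal_mul]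

omit [NeZero n] hM in
/-- transverse shifts do not move the profile: `κ ≠ ν ⟹ r((x + e_κ)_ν) = r(x_ν)`. [folklore] -/
theorem rT_add_unitVec_of_ne {ν κ : Fin d} (hκ : κ ≠ ν) (x : Tor (fine n M)) : rT n M ν (x + unitVec (fine n M) κ) = rT n M ν x := by
  rw [rT, rT, Pi.add_apply, unitVec, Pi.single_eq_of_ne (Ne.symm hκ), add_zero]

/-- **THE TOTAL SHIFT CORRELATION IS `≥ 1`** (`d ≥ 3`, `n ≥ 2`): each of the `d − 1` transverse directions contributes `Σ_x r(x_ν)² ≥ 1`, the longitudinal one at least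
`−Σ_x r(x_ν)²`. [folklore] -/
theorem one_le_shiftCorr (hd : 3 ≤ d) (hn : 2 ≤ n) (ν : Fin d) :
    (1 : ℝ) ≤ ∑ κ : Fin d, ∑ x : Tor (fine n M), rT n M ν x * rT n M ν (x + unitVec (fine n M) κ) := by
  set S2 : ℝ := ∑ x : Tor (fine n M), rT n M ν x * rT n M ν x
  have h01 : (0 : ZMod (fine n M ν)) ≠ 1 := fun h => by
    have h1 : fine n M ν = 1 := ZMod.one_eq_zero_iff.mp h.symm
    have hM1 : 1 ≤ M ν := Nat.one_le_iff_ne_zero.mpr (NeZero.ne (M ν))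
    have : n * 1 ≤ n * M ν := Nat.mul_le_mul_left n hM1
    simp only [fine] at h1
    omega
  have hS2 : 1 ≤ S2 := by
    have h := Finset.single_le_sum (f := fun x : Tor (fine n M) => rT n M ν x * rT n M ν x) (fun x _ => mul_self_nonneg _) (Finset.mem_univ (0 : Tor (fine n M)))
    have hr0 : rT n M ν 0 = 1 := by rw [rT, Pi.zero_apply, rfun, if_pos rfl, if_neg h01, sub_zero]
    rwa [hr0, mul_one] at h
  have htrans : ∀ κ ∈ (Finset.univ : Finset (Fin d)).erase ν, ∑ x : Tor (fine n M), rT n M ν x * rT n M ν (x + unitVec (fine n M) κ) = S2 := fun κ hκ =>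
    Finset.sum_congr rfl fun x _ => by rw [rT_add_unitVec_of_ne n M (Finset.ne_of_mem_erase hκ) x]
  have hlong : -S2 ≤ ∑ x : Tor (fine n M), rT n M ν x * rT n M ν (x + unitVec (fine n M) ν) := by
    have hshift : ∑ x : Tor (fine n M), rT n M ν (x + unitVec (fine n M) ν) * rT n M ν (x + unitVec (fine n M) ν) = S2 :=
      Fintype.sum_equiv (Equiv.addRight (unitVec (fine n M) ν)) _ _ fun x => rfl
    calc -S2 = ∑ x : Tor (fine n M), -((rT n M ν x * rT n M ν x + rT n M ν (x + unitVec (fine n M) ν) * rT n M ν (x + unitVec (fine n M) ν)) / 2) := by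
          rw [Finset.sum_neg_distrib, ← Finset.sum_div, Finset.sum_add_distrib, hshift]; ring
      _ ≤ _ := Finset.sum_le_sum fun x _ => by nlinarith [sq_nonneg (rT n M ν x + rT n M ν (x + unitVec (fine n M) ν))]
  have hcard : ((Finset.univ : Finset (Fin d)).erase ν).card = d - 1 := by
    rw [Finset.card_erase_of_mem (Finset.mem_univ _), Finset.card_univ, Fintype.card_fin]
  rw [← Finset.add_sum_erase _ _ (Finset.mem_univ ν), Finset.sum_congr rfl htrans, Finset.sum_const, hcard, nsmul_eq_mul]
  have hd' : (2 : ℝ) ≤ ((d - 1 : ℕ) : ℝ) := by exact_mod_cast (show 2 ≤ d - 1 by omega)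
  nlinarith

end Test

/-! ## §5 The full tier-B perturbation is a NON-ZERO operator: constant unitary transporters, the END's summand, the witness towers -/

section Main

variable (L : ℕ) [NeZero L] (M : Fin d → ℕ) [hM : ∀ μ, NeZero (M μ)] {o : Type} [Fintype o] [DecidableEq o]

/-- **MAIN LEMMA**: for a CONSTANT UNITARY transporter tower with `A_k ≠ 1`, `a ≥ 0`, block side `L^k ≥ 2`, `d ≥ 3`, and ANY transport error `E`, the tier-B perturbation
`covPertC(A) k + a((B+E)ᴴ(B+E) − BᴴB)_k` is a NON-ZERO OPERATOR: its quadratic form at `gtest ⊗ φ` is `|c|²·(Σ_ν⟨g,S_νg⟩)·‖(A_k − 1)φ‖² + a‖E_k(g ⊗ φ)‖² > 0`. [folklore] -/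
theorem tierBPert_const_gram_ne_zero (hd : 3 ≤ d) {k : ℕ} (hn : 2 ≤ lev L k) {A : ℕ → Matrix o o ℂ} (hAu : A k ∈ Matrix.unitaryGroup o ℂ) (hA1 : A k ≠ 1)
    {a : ℝ} (ha : 0 ≤ a) (E : (k : ℕ) → Matrix ((Tor M × Fin d) × o) (idx L M k × o) ℂ) :
    tierBPert L M (fun k _ _ => A k) (gramPert (a : ℂ) (Bfree (o := o) L M) E) (fun _ => 0) k ≠ 0 := by
  obtain ⟨φ, hφ⟩ : ∃ φ : o → ℂ, (A k - 1) *ᵥ φ ≠ 0 := by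
    by_contra h
    refine hA1 (sub_eq_zero.mp ?_)
    ext a b
    have := congrFun (not_not.mp (not_exists.mp h (Pi.single b 1))) a
    rwa [Matrix.mulVec_single_one, Pi.zero_apply] at this
  set μ₀ : Fin d := ⟨0, by omega⟩
  set ν : Fin d := ⟨1, by omega⟩
  have hne : ν ≠ μ₀ := fun h => by simpa [μ₀, ν] using (Fin.ext_iff.mp h)
  set g : idx L M k → ℂ := gtest (lev L k) M μ₀ ν with hg
  intro H
  have hform : star (pvec g φ) ⬝ᵥ (tierBPert L M (fun k _ _ => A k) (gramPert (a : ℂ) (Bfree (o := o) L M) E) (fun _ => 0) k *ᵥ pvec g φ) = 0 := by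
    rw [H, Matrix.zero_mulVec, dotProduct_zero]
  have hB : Bfree (o := o) L M k *ᵥ pvec g φ = 0 := by
    rw [Bfree, Matrix.smul_mulVec, kron_mulVec_pvec, hg, QvOp_mulVec_gtest (lev L k) M hn hne, pvec_zero_left, smul_zero]
  have h1 : star (pvec g φ) ⬝ᵥ (covPertC L M (fun k _ _ => A k) k *ᵥ pvec g φ) = (star ((lev L k : ℕ) : ℂ) * ((lev L k : ℕ) : ℂ))
      * (∑ κ, star g ⬝ᵥ (shiftM (fine (lev L k) M) κ *ᵥ g)) * (star ((A k - 1) *ᵥ φ) ⬝ᵥ ((A k - 1) *ᵥ φ)) := by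
    rw [covPertC]; exact form_covPert_const (fine (lev L k) M) hAu _ (star_gtest (lev L k) M μ₀ ν) φ
  rw [tierBPert, Matrix.add_mulVec, Matrix.add_mulVec, dotProduct_add, dotProduct_add, Matrix.zero_mulVec, dotProduct_zero, add_zero, h1,
    form_gramPert_of_ker (a : ℂ) (Bfree (o := o) L M) E k hB] at hform
  have hcorr : ∑ κ, star g ⬝ᵥ (shiftM (fine (lev L k) M) κ *ᵥ g)
      = ((∑ κ : Fin d, ∑ x : Tor (fine (lev L k) M), rT (lev L k) M ν x * rT (lev L k) M ν (x + unitVec (fine (lev L k) M) κ) : ℝ) : ℂ) := by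
    rw [Complex.ofReal_sum]
    exact Finset.sum_congr rfl fun κ _ => shiftCorr_gtest (lev L k) M μ₀ ν κ
  have hcorr_pos : (0 : ℂ) < ∑ κ, star g ⬝ᵥ (shiftM (fine (lev L k) M) κ *ᵥ g) := by
    rw [hcorr]
    exact Complex.zero_lt_real.mpr (lt_of_lt_of_le one_pos (one_le_shiftCorr (lev L k) M hd hn ν))
  have hc_pos : (0 : ℂ) < star ((lev L k : ℕ) : ℂ) * ((lev L k : ℕ) : ℂ) := by
    rw [Complex.star_def, map_natCast, ← Nat.cast_mul]
    exact_mod_cast Nat.mul_pos (Nat.pos_of_ne_zero (NeZero.ne (lev L k))) (Nat.pos_of_ne_zero (NeZero.ne (lev L k)))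
  have hpos : (0 : ℂ) < star ((lev L k : ℕ) : ℂ) * ((lev L k : ℕ) : ℂ) * (∑ κ, star g ⬝ᵥ (shiftM (fine (lev L k) M) κ *ᵥ g))
      * (star ((A k - 1) *ᵥ φ) ⬝ᵥ ((A k - 1) *ᵥ φ)) + (a : ℂ) * (star (E k *ᵥ pvec g φ) ⬝ᵥ (E k *ᵥ pvec g φ)) :=
    add_pos_of_pos_of_nonneg (mul_pos (mul_pos hc_pos hcorr_pos) (Matrix.dotProduct_star_self_pos_iff.mpr hφ))
      (mul_nonneg (Complex.zero_le_real.mpr ha) (dotProduct_star_self_nonneg _))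
  exact (ne_of_gt hpos) hform

/-- **… WITH THE END's COMPOSED-AVERAGING SUMMAND**: for ANY table datum `T` and ANY remainder `E″`, `tierBPert (const A) (avgPertFull a T E″) 0 k ≠ 0` (constant unitary
`A_k ≠ 1`, `a ≥ 0`, `L^k ≥ 2`, `d ≥ 3`). [cite: Balaban1985BackgroundPropagators, (3.16) p.393, (3.26) p.395 (shape)] [folklore] -/
theorem tierBPert_const_avgPertFull_ne_zero (hd : 3 ≤ d) {k : ℕ} (hn : 2 ≤ lev L k) {A : ℕ → Matrix o o ℂ} (hAu : A k ∈ Matrix.unitaryGroup o ℂ)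
    (hA1 : A k ≠ 1) {a : ℝ} (ha : 0 ≤ a) (T : (k : ℕ) → Table d (lev L k) M o) (Erem : (k : ℕ) → Matrix ((Tor M × Fin d) × o) (idx L M k × o) ℂ) :
    tierBPert L M (fun k _ _ => A k) (avgPertFull L M a T Erem) (fun _ => 0) k ≠ 0 :=
  tierBPert_const_gram_ne_zero L M hd hn hAu hA1 ha (fun k => EcovT L M T k + Erem k)

/-- CONTRAST — **THE FLAT VALUE IS THE ZERO OPERATOR**: at the flat transporters `R ≡ 1` with the flat tables `TBal 1` and no remainder, `tierBPert 1 (avgPertFull a (TBal 1) 0) 0 k = 0`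
(so the END's operator at the flat tower is the free block-Laplacian tower `calDalev ⊗ 1`). [folklore] -/
theorem tierBPert_flat_tables_eq_zero [NeZero d] (a : ℝ) (k : ℕ) :
    tierBPert L M (fun _ _ _ => (1 : Matrix o o ℂ)) (avgPertFull L M a (fun k => TBal L M (fun _ _ _ => (1 : Matrix o o ℂ)) k) (fun _ => 0)) (fun _ => 0) k = 0 := by
  rw [tierBPert, (covPertC_const_eq_zero_iff L M (fun _ => (1 : Matrix o o ℂ)) k).mpr rfl, avgPertFull_zero L M a _, avgPertT_TBal_one L M a k, zero_add, add_zero]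

variable {n : Type} [Fintype n] [DecidableEq n] [Nonempty n] {ι : Type} [Fintype ι] [DecidableEq ι]
  {c : ℝ} {P : Submodule ℝ (Matrix n n ℂ)} {e : ι → Matrix n n ℂ} (hF : CompFamily c P e)

/-- **AT THE WITNESS TOWERS OF GENERATION 8 THE FULL TIER-B PERTURBATION IS A NON-ZERO OPERATOR**: for skew-hermitian NON-CENTRAL `X` with `‖X‖ < ln 2`, a frame containing
su(N), `f` with `0 < f(k,k) ≤ 1` (both `cph` and `sph` qualify), `a ≥ 0`, `d ≥ 3`, block side `L^k ≥ 2`, and ANY tables `T` ∕ remainders `E″` — in particular the END's own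
`TBal(Ad u)` with `E″ = 0` (reduced END) or `E″ = Erem` (full END): `tierBPert (Ad u_top) (avgPertFull a T E″) 0 k ≠ 0`.  The composed-averaging summand does NOT compensate
the covariant-Laplacian one. [folklore] -/
theorem tierBPert_cTow_ne_zero (hP : herm0 n ≤ P) (hd : 3 ≤ d) {f : ℕ → ℕ → ℝ} {X : Matrix n n ℂ} (hX : star X = -X) (hXs : ‖X‖ < Real.log 2)
    (hXc : X ∉ Set.range (Matrix.scalar n)) {k : ℕ} (hn : 2 ≤ lev L k) (hf0 : 0 < f k k) (hf1 : f k k ≤ 1) {a : ℝ} (ha : 0 ≤ a)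
    (T : (k : ℕ) → Table d (lev L k) M ι) (Erem : (k : ℕ) → Matrix ((Tor M × Fin d) × ι) (idx L M k × ι) ℂ) :
    tierBPert L M (topAdT L M hF (liftU L M (cTow L M f X) (cTow_mem L M f hX))) (avgPertFull L M a T Erem) (fun _ => 0) k ≠ 0 := by
  haveI : NeZero d := ⟨by omega⟩
  have hA1 : adRep hF ⟨NormedSpace.exp (((f k k : ℝ) : ℂ) • X), exp_smul_mem_unitaryGroup hX _⟩ ≠ 1 := fun h1 =>
    hXc ((topAdT_cTow_eq_one_iff hF L M hP hX hXs hf0 hf1 (0 : Fin d) (((fun _ => 0), (0 : Fin d)) : idx L M k)).mp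
      (by rw [topAdT_cTow_eq_const L M hF f hX]; exact h1))
  rw [topAdT_cTow_eq_const L M hF f hX]
  exact tierBPert_const_avgPertFull_ne_zero L M hd hn (A := fun k => adRep hF ⟨NormedSpace.exp (((f k k : ℝ) : ℂ) • X), exp_smul_mem_unitaryGroup hX _⟩)
    (adRep_mem_unitaryGroup hF _) hA1 ha T Erem

/-- **THE REDUCED END's OPERATOR AT THE WITNESS IS NOT THE FREE ONE**: the level-`k` operator displayed in `ComposedRemainderCoherentTowerReduced.exists_nonflat_coherent_witness_reduced`,
`calDalev_k ⊗ 1 + tierBPert (Ad u_top) (avgPertFull a (TBal(Ad u)) 0) 0 k`, differs from the free block-Laplacian tower `calDalev_k ⊗ 1` — its value at the flat tower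
(`tierBPert_flat_tables_eq_zero`) — at every level with `L^k ≥ 2` (`d ≥ 3`, non-central `X`).  TOY data; NE2 NOT proved. [folklore] -/
theorem reducedEND_operator_ne_free (hP : herm0 n ≤ P) (hd : 3 ≤ d) {f : ℕ → ℕ → ℝ} {X : Matrix n n ℂ} (hX : star X = -X) (hXs : ‖X‖ < Real.log 2)
    (hXc : X ∉ Set.range (Matrix.scalar n)) {k : ℕ} (hn : 2 ≤ lev L k) (hf0 : 0 < f k k) (hf1 : f k k ≤ 1) {a : ℝ} (ha : 0 < a) :
    calDalev L M a ha k ⊗ₖ (1 : Matrix ι ι ℂ)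
        + tierBPert L M (topAdT L M hF (liftU L M (cTow L M f X) (cTow_mem L M f hX)))
            (avgPertFull L M a (fun k => TBal L M (adT L M hF (liftU L M (cTow L M f X) (cTow_mem L M f hX) k)) k) (fun _ => 0)) (fun _ => 0) k
      ≠ calDalev L M a ha k ⊗ₖ (1 : Matrix ι ι ℂ) := fun h =>
  tierBPert_cTow_ne_zero L M hF hP hd hX hXs hXc hn hf0 hf1 ha.le _ _ (add_left_cancel (h.trans (add_zero _).symm))

end Main

end Summit.QuantumFields.BalabanUV.T4Continuum.NE2.FullOperatorWitnessNonTrivial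

end
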